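import Literature.AnabelianGeometry.SemiGraphs.WitnessIwahoriCuspChart
import Literature.AnabelianGeometry.SemiGraphs.TemperedEdgeLikeProofs
import HarnessLib

/-!
# The edge-like subgroups of the CUSP of `cuspGraph p` for the explicit chart `π₁^temp = P`: exactly the
# conjugates of the torus — and why [SemiAnbd] Thm. 3.7 (iv) speaks of CLOSED edges

Mochizuki, *Semi-graphs of anabelioids*, Publ. RIMS **42** (2006) [MochizukiSemiAnbd2006], Thm. 3.7 (iii)
pp. 40–41 ("Every compact subgroup … is contained in the image of some `π̂₁(G_e)`, for some edge `e`"), (iv)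
p. 41 ("The nontrivial intersections of two distinct maximal compact subgroups of `π₁^temp(G)` are precisely
the edge-like subgroups"), Rmk. 3.9.1 p. 43 (open edges).

PROOF-ONLY sequel (no `def`, no `instance`) of `WitnessIwahoriCuspChart.lean` (abc-iut-f-177: the explicit
chart `cuspChart p` of the one-vertex-one-cusp semi-graph of anabelioids `cuspGraph p`, `π₁^temp = P =
ℤ_p ⋊ (1 + pℤ_p)` on the nose, verticial subgroups `= {⊤}`), using the tree's general Thm-3.7 (iii)
vocabulary lemmas (`isEdgeHom_comp_brHom`, `map_branchSubgroup_mem_edgeLikeSubgroups`,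
`exists_eq_map_branchSubgroup_of_mem_edgeLikeSubgroups`, abc-iut-L3-t11 / R-lineage) BY NAME:

* `isEdgeHom_bHom_cuspChart` — the torus embedding `b_0 : U ↪ P` IS an edge homomorphism at the cusp;
* `torus_mem_edgeLikeSubgroups_cuspChart` — the torus `T_0 = b_0(U)` is an edge-like subgroup;
* `edgeLikeSubgroups_cuspChart_eq` — **the edge-like subgroups of the cusp are EXACTLY the `P`-conjugates
  `g T_0 g⁻¹` of the torus** (verticial homomorphisms of `cuspChart` are inner);
* `not_edgeLike_eq_inf_verticial_cuspChart` — the open edge's edge-like subgroup `T_0 ≠ ⊥` is NOT the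
  intersection of two DISTINCT verticial subgroups (there is only one, `⊤`, and `T_0 ≠ ⊤`): a kernel model of
  why the tree types the second sentence of Thm. 3.7 (iv) / the residual `EdgeLikeIsInfVerticial` for CLOSED
  edges only (audit A-L3t2-F2, ruling κ; Rmk. 3.9.1: an open edge's group lies in a single verticial
  subgroup) — dropping `IsClosedEdge` would make them FALSE at `cuspGraph p`.

A witness certifies consistency / sharpness only; no statement of the paper is touched; nothing here bears
on [IUTchIII] Cor. 3.12.
-/

noncomputable section

namespace Literature.AnabelianGeometry.SemiGraphs

namespace IwahoriWitness

open CategoryTheory Topology ProfiniteSemiGraph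

variable (p : ℕ) [Fact p.Prime]

/-! ### The torus is edge-like -/

/-- **The torus embedding `b_0 : U ↪ P` is an edge homomorphism** at the cusp of `cuspGraph p` for the
explicit chart (`= id_P ∘ b_0` with `id_P` verticial, `isEdgeHom_comp_brHom`).
[cite: MochizukiSemiAnbd2006, Thm 3.7(iii) p.41] -/
theorem isEdgeHom_bHom_cuspChart (e : (cuspGraph p).graph.Edge) :
    IsEdgeHom (cuspChart p) e ((ContinuousMonoidHom.id (Iw p)).comp (Iw.bHom (p := p) 0)) :=
  isEdgeHom_comp_brHom (cuspChart p) (b := true) (w := PUnit.unit) rfl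
    (isVerticialHom_id_cuspChart p PUnit.unit)

/-- **The torus `T_0 = b_0(U)` is an edge-like subgroup** of `π₁^temp(cuspGraph p) = P` at the cusp.
[cite: MochizukiSemiAnbd2006, Thm 3.7(iii) p.41] -/
theorem torus_mem_edgeLikeSubgroups_cuspChart (e : (cuspGraph p).graph.Edge) :
    (Iw.bHom (p := p) 0).toMonoidHom.range ∈ edgeLikeSubgroups (cuspChart p) e :=
  ⟨(ContinuousMonoidHom.id (Iw p)).comp (Iw.bHom (p := p) 0), isEdgeHom_bHom_cuspChart p e,
    Subgroup.ext fun _ => Iff.rfl⟩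

/-- Conjugation by `g ∈ P` is a verticial homomorphism of `cuspChart p` (conjugate of the verticial `id_P`).
[cite: MochizukiSemiAnbd2006, Thm 3.7(i) p.40] -/
theorem isVerticialHom_conjHom_cuspChart (v : (cuspGraph p).graph.Vertex) (g : Iw p) :
    IsVerticialHom (cuspChart p) v (conjHom p g) := by
  obtain ⟨η⟩ := isVerticialHom_id_cuspChart p v
  exact ⟨η ≪≫ BTemp.resIsoOfConj (ContinuousMonoidHom.id (Iw p)) (conjHom p g) g fun _ => rfl⟩

/-- **The edge-like subgroups of the cusp are EXACTLY the `P`-conjugates of the torus**: `L` is edge-like at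
the cusp for `cuspChart p` iff `L = g T_0 g⁻¹` for some `g ∈ P` (every verticial homomorphism of the
explicit chart is inner, `exists_conj_eq_of_isVerticialHom_cuspChart`; conversely conjugates of verticial
homomorphisms are verticial). [cite: MochizukiSemiAnbd2006, Thm 3.7(iii) p.41] -/
theorem edgeLikeSubgroups_cuspChart_eq (e : (cuspGraph p).graph.Edge) :
    edgeLikeSubgroups (cuspChart p) e =
      {L | ∃ g : Iw p, L = ((Iw.bHom (p := p) 0).toMonoidHom.range).map (MulAut.conj g).toMonoidHom} := by
  obtain ⟨⟩ := e
  ext L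
  constructor
  · intro hL
    obtain ⟨ψ, hψ, rfl⟩ := exists_eq_map_branchSubgroup_of_mem_edgeLikeSubgroups (cuspChart p) true
      PUnit.unit rfl ⟨_, isVerticialHom_id_cuspChart p PUnit.unit⟩ hL
    obtain ⟨g, hg⟩ := exists_conj_eq_of_isVerticialHom_cuspChart p PUnit.unit ψ hψ
    refine ⟨g, ?_⟩
    rw [cuspGraph_branchSubgroup]
    ext x
    simp only [Subgroup.mem_map]
    constructor
    · rintro ⟨y, hy, rfl⟩
      exact ⟨y, hy, hg y⟩
    · rintro ⟨y, hy, rfl⟩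
      exact ⟨y, hy, (hg y).symm⟩
  · rintro ⟨g, rfl⟩
    have h := map_branchSubgroup_mem_edgeLikeSubgroups (cuspChart p) true PUnit.unit rfl
      (isVerticialHom_conjHom_cuspChart p PUnit.unit g)
    rw [cuspGraph_branchSubgroup] at h
    exact h

/-! ### Why Thm. 3.7 (iv) / `EdgeLikeIsInfVerticial` speak of CLOSED edges -/

/-- The torus is a nontrivial subgroup of `P` (it is infinite). [cite: MochizukiSemiAnbd2006, Def 2.4(iv) p.26] -/
theorem torus_ne_bot : (Iw.bHom (p := p) 0).toMonoidHom.range ≠ ⊥ := by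
  intro h
  haveI := Iw.infinite_range_bHom (p := p) 0
  have : Finite (Iw.bHom (p := p) 0).toMonoidHom.range := by
    rw [h]
    infer_instance
  exact not_finite (Iw.bHom (p := p) 0).toMonoidHom.range

/-- The torus is a proper subgroup of `P`: the translation `(1, 0)` is not on it.
[cite: MochizukiSemiAnbd2006, Def 2.4(iv) p.26] -/
theorem torus_ne_top : (Iw.bHom (p := p) 0).toMonoidHom.range ≠ ⊤ := by
  intro h
  have hmem : (⟨1, 0⟩ : Iw p) ∈ (Iw.bHom (p := p) 0).toMonoidHom.range := by
    rw [h]; exact Subgroup.mem_top _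
  rw [Iw.mem_range_bHom_iff] at hmem
  simp at hmem

/-- **At the cusp of `cuspGraph p`, a nontrivial edge-like subgroup is NOT the intersection of two distinct
verticial subgroups** (all verticial subgroups of the explicit chart equal `⊤`, and `T_0 ≠ ⊤`): the
CLOSED-edge restriction in the tree's typing of [SemiAnbd] Thm. 3.7 (iv), second sentence
(`MaximalCompactIffVerticial`, residual `EdgeLikeIsInfVerticial`; audit A-L3t2-F2, ruling κ; cf. Rmk. 3.9.1)
cannot be dropped. [cite: MochizukiSemiAnbd2006, Thm 3.7(iv) p.41] -/
theorem not_edgeLike_eq_inf_verticial_cuspChart (e : (cuspGraph p).graph.Edge) :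
    ¬ ∀ L ∈ edgeLikeSubgroups (cuspChart p) e, L ≠ ⊥ →
        ∃ (v₁ v₂ : (cuspGraph p).graph.Vertex) (H₁ H₂ : Subgroup (cuspChart p).G),
          H₁ ∈ verticialSubgroups (cuspChart p) v₁ ∧ H₂ ∈ verticialSubgroups (cuspChart p) v₂ ∧
            H₁ ≠ H₂ ∧ L = H₁ ⊓ H₂ := by
  intro h
  obtain ⟨v₁, v₂, H₁, H₂, hH₁, hH₂, hne, -⟩ :=
    h _ (torus_mem_edgeLikeSubgroups_cuspChart p e) (torus_ne_bot p)
  rw [verticialSubgroups_cuspChart_eq, Set.mem_singleton_iff] at hH₁ hH₂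
  exact hne (hH₁.trans hH₂.symm)

/-- The cusp of `cuspGraph p` is an OPEN edge whose (nontrivial) edge-like subgroups lie in a SINGLE verticial
subgroup — the kernel form of [SemiAnbd] Rmk. 3.9.1 at this witness: every edge-like subgroup at the cusp is
a proper subgroup of the unique verticial subgroup `⊤`. [cite: MochizukiSemiAnbd2006, Rmk 3.9.1 p.43] -/
theorem edgeLike_lt_top_cuspChart (e : (cuspGraph p).graph.Edge) (L : Subgroup (Iw p))
    (hL : L ∈ edgeLikeSubgroups (cuspChart p) e) : L < ⊤ := by
  rw [edgeLikeSubgroups_cuspChart_eq] at hL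
  obtain ⟨g, rfl⟩ := hL
  refine lt_top_iff_ne_top.mpr fun h => torus_ne_top p ?_
  have h' := congrArg (Subgroup.comap (MulAut.conj g).toMonoidHom) h
  rwa [Subgroup.comap_map_eq_self_of_injective (MulAut.conj g).injective, Subgroup.comap_top] at h'

end IwahoriWitness

end Literature.AnabelianGeometry.SemiGraphs

end
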